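import Summits.MatrixMultiplication.MatrixMultiplication.Theorems.FarEdgeDescentSupportStratumDoor
import Summits.MatrixMultiplication.MatrixMultiplication.Theorems.FarEdgeDescentStratumPinning
import Literature.Computability.AlgebraicComplexity.AsymptoticRankZariskiClosedProofs
import Mathlib.Analysis.Complex.Cardinality
import Mathlib.Algebra.Polynomial.Roots
import Mathlib.Data.Set.Card
import HarnessLib

/-!
# Generic domination on the BCZ line: the generic member of the same-support stratum of `⟨2,2,2⟩` bounds `ω`

Route `FarEdgeDescent` (cell `decomp-mm`, lens 2 «structural dichotomy (special vs generic)»,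
gen 34), Kernel IX-b; support for the aside `SubLogRate` (stmt-MatrixMultiplication-25371).

Kernels VII/VIII put the summit tensor `⟨2,2,2⟩ ≅ 𝔖(1)` (`fam_one`) on the ONE-PARAMETER line
`q ↦ 𝔖(q) = fam ℂ q` of Bläser–Christandl–Zuiddam normal forms of its same-support stratum, showed
that the special point `q = 1` reaches no other member (`matMul_not_algDegeneratesTo_fam`), and
that every member is a door (`summit_of_asymptoticRank_fam_le_four`: `R̃(𝔖(q)) ≤ 4 ⟹ ω = 2`).
This file makes the lens's special/generic split on that line a THEOREM, using the tree's proof of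
Christandl–Hoeberechts–Nieuwboer–Vrana–Zuiddam, Thm. 1.2 (`chnvz_zariskiClosed_asymptoticRank_le_holds`:
sublevel sets of `R̃` are Zariski-closed over every field):

* §1, any field `F`, any affine line `q ↦ t₀ + q • t₁` of tensors of a fixed format: **every
  sublevel set `{q | R̃(t₀ + q • t₁) ≤ r}` is all of `F` or finite**
  (`sublevel_eq_univ_or_finite`) — a Zariski-closed subset of the line; over an UNCOUNTABLE field a
  **dominant parameter** exists (`exists_dominant`: `R̃(t₀ + q • t₁) ≤ R̃(t₀ + q₀ • t₁)` for all
  `q`), the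
  non-dominant (special) parameters form a **countable** set (`countable_special`: below every
  attained value lie countably many parameters) and are **finitely many below every level
  `c < R̃(t₀ + q₀ • t₁)`** (`finite_sublevel_of_lt`); all
  dominant (generic) parameters share one value.  This is CHNVZ's Cor. 4.4 / Thm. 4.3 (existence of
  maximisers on a Zariski-closed set, over `ℂ`, via Baire) in the elementary form available on a
  line (Zariski-closed = finite or everything; countable union of finite sets ≠ uncountable field).
* §2, the BCZ line over `ℂ` (`line_eq_fam : 𝔖(0) + q • (𝔖(1) − 𝔖(0)) = 𝔖(q)`, the weight enters
  one block linearly):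
  `exists_dominant_fam` and **`rpow_omega_le_asymptoticRank_fam_of_dominant : 2^ω = R̃(𝔖(1)) ≤ R̃(𝔖(q₀))`**
  for every dominant `q₀` — the generic member DOMINATES the special point `⟨2,2,2⟩`; hence
  **`omega_le_of_dominant : R̃(𝔖(q₀)) ≤ 2^τ ⟹ ω ≤ τ`** (for the generic member the Cohn–Umans
  door `ω ≤ (3τ − 2)/2` of Kernel VIII-a, `omega_le_of_asymptoticRank_weightedStar_le`, improves to
  the identity map `τ ↦ τ`), **`omega_le_of_infinite_flat : {q | R̃(𝔖(q)) ≤ 2^τ}` infinite ⟹ ω ≤ τ**,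
  the dichotomy `flatLocus_eq_univ_or_finite : {q | R̃(𝔖(q)) ≤ 2^τ} = ℂ` or finite, and the special
  side `countable_special_fam` / `finite_special_fam_below`: the members NOT attaining the generic
  asymptotic rank are countably many, finitely many below each level.
* What is NOT proved (and is the lens's standing question 7 of ASK I-g33a): `ω = 2 ⟹ R̃(𝔖(q₀)) = 4`
  for a dominant `q₀` (necessity of generic flatness); with this file it is equivalent to
  `ω = 2 ⟹ R̃` constant `= 4` off a countable set.  Under Strassen's asymptotic rank conjecture it
  holds (`summit_and_twins_of_arc`).  Nothing here bounds `ω` numerically.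

References: M. Christandl, K. Hoeberechts, H. Nieuwboer, P. Vrana, J. Zuiddam, *Asymptotic tensor
rank is characterized by polynomials*, STOC 2025 = arXiv:2411.15789, Thm. 1.2, Thm. 4.3, Cor. 4.4 and
the remark on `cw₂` in §1.2 ("`cw₂` has asymptotic rank at most the generic asymptotic rank of …
tensors with [its] support") [ChristandlHoeberechtsNieuwboerVranaZuiddam2025]; M. Bläser,
M. Christandl, J. Zuiddam, *The border support rank of two-by-two matrix multiplication is seven*,
Chic. J. TCS 2018 (arXiv:1705.09652), §2 [BlaserChristandlZuiddam2017]; A. Conner, F. Gesmundo,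
J. M. Landsberg, E. Ventura, Y. Wang, Collect. Math. 72 (2021), §1 (semicontinuity under
degeneration only) [ConnerGesmundoLandsbergVenturaWang2020].
-/

noncomputable section

open scoped BigOperators Polynomial

set_option linter.dupNamespace false

namespace Summit.MatrixMultiplication.MatrixMultiplication.Theorems.FarEdgeDescentGenericDomination

open Literature.Computability.AlgebraicComplexity
open Summit.MatrixMultiplication.MatrixMultiplication.Theorems.FarEdgeDescentSignTwist
open Summit.MatrixMultiplication.MatrixMultiplication.Theorems.FarEdgeDescentSignTwistDet
open Summit.MatrixMultiplication.MatrixMultiplication.Theorems.FarEdgeDescentWeightFamily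
open Summit.MatrixMultiplication.MatrixMultiplication.Theorems.FarEdgeDescentSupportStratumDoor
open Summit.MatrixMultiplication.MatrixMultiplication.Theorems.FarEdgeDescentStratumPinning

/-! ## 1. Affine lines of tensors -/

section Line

variable {F : Type} [Field F] {ι κ μ : Type}

/-- Substituting the line `q ↦ t₀ + q • t₁` into a polynomial `p` in the tensor entries and
evaluating at `q` gives `p(t₀ + q • t₁)`. [folklore] -/
theorem eval_aeval_line (t₀ t₁ : ι → κ → μ → F) (p : MvPolynomial (ι × κ × μ) F) (q : F) :
    (MvPolynomial.aeval (fun x => Polynomial.C (tensorEntries t₀ x) +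
        Polynomial.X * Polynomial.C (tensorEntries t₁ x)) p).eval q =
      MvPolynomial.eval (tensorEntries (t₀ + q • t₁)) p := by
  have hfun : (fun x => Polynomial.aeval q (Polynomial.C (tensorEntries t₀ x) +
      Polynomial.X * Polynomial.C (tensorEntries t₁ x))) = tensorEntries (t₀ + q • t₁) := by
    funext x
    simp only [Polynomial.coe_aeval_eq_eval, Polynomial.eval_add, Polynomial.eval_C,
      Polynomial.eval_mul, Polynomial.eval_X, tensorEntries, Pi.add_apply, Pi.smul_apply,
      smul_eq_mul]
  rw [← Polynomial.coe_aeval_eq_eval, ← AlgHom.comp_apply, MvPolynomial.comp_aeval,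
    MvPolynomial.aeval_eq_eval, hfun]

variable [Fintype ι] [Fintype κ] [Fintype μ]

/-- **Sublevel dichotomy on a line.** For every affine line `q ↦ t₀ + q • t₁` of tensors over any
field and every level `r`, the set of parameters `q` with `R̃(t₀ + q • t₁) ≤ r` is either the whole
line or finite: by CHNVZ Thm. 1.2 it is cut out by the one-variable polynomials `p(t₀ + X t₁)`, `p`
vanishing on `{R̃ ≤ r}`, and a one-variable polynomial is zero or has finitely many roots.
[cite: ChristandlHoeberechtsNieuwboerVranaZuiddam2025, Theorem 1.2] -/
theorem sublevel_eq_univ_or_finite (t₀ t₁ : ι → κ → μ → F) (r : ℝ) :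
    {q : F | asymptoticRank (t₀ + q • t₁) ≤ r} = Set.univ ∨
      {q : F | asymptoticRank (t₀ + q • t₁) ≤ r}.Finite := by
  classical
  by_cases hall : ∀ p : MvPolynomial (ι × κ × μ) F,
      (∀ S : ι → κ → μ → F, asymptoticRank S ≤ r → MvPolynomial.eval (tensorEntries S) p = 0) →
        MvPolynomial.aeval (fun x => Polynomial.C (tensorEntries t₀ x) +
          Polynomial.X * Polynomial.C (tensorEntries t₁ x)) p = 0
  · refine Or.inl (Set.eq_univ_of_forall fun q => ?_)
    refine chnvz_zariskiClosed_asymptoticRank_le_holds F ι κ μ r (t₀ + q • t₁) fun p hp => ?_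
    rw [← eval_aeval_line, hall p hp, Polynomial.eval_zero]
  · push Not at hall
    obtain ⟨p, hp, hp0⟩ := hall
    refine Or.inr ((Polynomial.finite_setOf_isRoot hp0).subset fun q hq => ?_)
    show Polynomial.eval q _ = 0
    rw [eval_aeval_line]
    exact hp _ hq

/-- A set of reals each of whose initial segments `V ∩ (-∞, c]`, `c ∈ V`, is finite is countable:
`c ↦ #(V ∩ (-∞, c])` is injective on it. [folklore] -/
theorem countable_of_finite_initialSegments {V : Set ℝ} (hV : ∀ c ∈ V, (V ∩ Set.Iic c).Finite) :
    V.Countable := by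
  refine Set.countable_iff_exists_injOn.2 ⟨fun c => (V ∩ Set.Iic c).ncard, fun c hc c' hc' h => ?_⟩
  dsimp only at h
  have key : ∀ {a b : ℝ}, b ∈ V → a < b → (V ∩ Set.Iic a).ncard < (V ∩ Set.Iic b).ncard :=
    fun {a b} hb hab => Set.ncard_lt_ncard
      ⟨fun x hx => ⟨hx.1, le_trans (Set.mem_Iic.1 hx.2) hab.le⟩,
        fun hsub => not_le.2 hab (Set.mem_Iic.1 (hsub ⟨hb, Set.mem_Iic.2 le_rfl⟩).2)⟩ (hV b hb)
  by_contra hne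
  rcases lt_or_gt_of_ne hne with hlt | hlt
  · exact absurd h (key hc' hlt).ne
  · exact absurd h.symm (key hc hlt).ne

/-- Every sublevel set strictly below an ATTAINED value `R̃(t₀ + q₀ • t₁)` is FINITE: the special
parameters are finitely many at each level. [cite: ChristandlHoeberechtsNieuwboerVranaZuiddam2025, Theorem 1.2] -/
theorem finite_sublevel_of_lt {t₀ t₁ : ι → κ → μ → F} {q₀ : F} {c : ℝ}
    (hc : c < asymptoticRank (t₀ + q₀ • t₁)) :
    {q : F | asymptoticRank (t₀ + q • t₁) ≤ c}.Finite :=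
  (sublevel_eq_univ_or_finite t₀ t₁ c).resolve_left fun huniv =>
    not_le.2 hc (show q₀ ∈ {q : F | asymptoticRank (t₀ + q • t₁) ≤ c} from huniv ▸ Set.mem_univ q₀)

/-- **Strictly below every attained value there are only countably many parameters**: for every
`q₀` the set of `q` with `R̃(t₀ + q • t₁) < R̃(t₀ + q₀ • t₁)` is countable (the values below
`R̃(t₀ + q₀ • t₁)` have finite initial segments, and each is taken finitely often); for a dominant
`q₀` this is the set of special parameters. [cite: ChristandlHoeberechtsNieuwboerVranaZuiddam2025, Theorem 1.2] -/
theorem countable_special (t₀ t₁ : ι → κ → μ → F) (q₀ : F) :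
    {q : F | asymptoticRank (t₀ + q • t₁) < asymptoticRank (t₀ + q₀ • t₁)}.Countable := by
  set v : F → ℝ := fun q => asymptoticRank (t₀ + q • t₁) with hv
  set N : Set F := {q : F | v q < v q₀} with hN
  have hfin : ∀ q' ∈ N, {q : F | v q ≤ v q'}.Finite := fun q' hq' =>
    finite_sublevel_of_lt (t₀ := t₀) (t₁ := t₁) (q₀ := q₀) (c := v q') hq'
  have hV : (v '' N).Countable := by
    refine countable_of_finite_initialSegments fun c hc => ?_
    obtain ⟨q', hq', rfl⟩ := hc
    refine ((hfin q' hq').image v).subset ?_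
    rintro _ ⟨⟨q, -, rfl⟩, hle⟩
    exact ⟨q, hle, rfl⟩
  have hcover : N ⊆ ⋃ c ∈ v '' N, {q : F | v q ≤ c} := fun q hq =>
    Set.mem_biUnion ⟨q, hq, rfl⟩ (show q ∈ {q' : F | v q' ≤ v q} from le_refl (v q))
  exact Set.Countable.mono hcover (hV.biUnion fun c hc => by
    obtain ⟨q', hq', rfl⟩ := hc
    exact (hfin q' hq').countable)

/-- **A dominant (generic) parameter exists over every uncountable field**: otherwise every sublevel
set at an attained level is finite, the attained values have finite initial segments (so are
countably many), and the field would be a countable union of finite sets.  (CHNVZ, Cor. 4.4, prove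
existence of maximisers on every Zariski-closed set over `ℂ` by a Baire argument; on a line this is
the elementary count.) [cite: ChristandlHoeberechtsNieuwboerVranaZuiddam2025, Corollary 4.4] -/
theorem exists_dominant (hF : ¬ (Set.univ : Set F).Countable) (t₀ t₁ : ι → κ → μ → F) :
    ∃ q₀ : F, ∀ q : F, asymptoticRank (t₀ + q • t₁) ≤ asymptoticRank (t₀ + q₀ • t₁) := by
  set v : F → ℝ := fun q => asymptoticRank (t₀ + q • t₁) with hv
  by_contra h
  push Not at h
  have hfin : ∀ q₀ : F, {q : F | v q ≤ v q₀}.Finite := by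
    intro q₀
    refine (sublevel_eq_univ_or_finite t₀ t₁ (v q₀)).resolve_left fun huniv => ?_
    obtain ⟨q, hq⟩ := h q₀
    exact not_lt.2 (show q ∈ {q : F | v q ≤ v q₀} from huniv ▸ Set.mem_univ q) hq
  have hV : (Set.range v).Countable := by
    refine countable_of_finite_initialSegments fun c hc => ?_
    obtain ⟨q₀, rfl⟩ := hc
    refine ((hfin q₀).image v).subset ?_
    rintro _ ⟨⟨q, rfl⟩, hle⟩
    exact ⟨q, hle, rfl⟩
  have hcover : (Set.univ : Set F) ⊆ ⋃ c ∈ Set.range v, {q : F | v q ≤ c} := fun q _ =>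
    Set.mem_biUnion (Set.mem_range_self q) (show q ∈ {q' : F | v q' ≤ v q} from le_refl (v q))
  refine hF (Set.Countable.mono hcover (hV.biUnion fun c hc => ?_))
  obtain ⟨q₀, rfl⟩ := hc
  exact (hfin q₀).countable

/-- Dominant parameters share one value: the generic asymptotic rank of the line. [folklore] -/
theorem asymptoticRank_eq_of_dominant {t₀ t₁ : ι → κ → μ → F} {q₀ q₁ : F}
    (hq₀ : ∀ q : F, asymptoticRank (t₀ + q • t₁) ≤ asymptoticRank (t₀ + q₀ • t₁))
    (hq₁ : ∀ q : F, asymptoticRank (t₀ + q • t₁) ≤ asymptoticRank (t₀ + q₁ • t₁)) :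
    asymptoticRank (t₀ + q₀ • t₁) = asymptoticRank (t₀ + q₁ • t₁) :=
  le_antisymm (hq₁ q₀) (hq₀ q₁)

end Line

/-! ## 2. The BCZ line `q ↦ 𝔖(q)` through `⟨2,2,2⟩ = 𝔖(1)` over `ℂ` -/

section BCZ

/-- The family is affine in the modulus: `𝔖(q) = 𝔖(0) + q · (𝔖(1) − 𝔖(0))` (the weight `q`
enters one block linearly). [cite: BlaserChristandlZuiddam2017, §2] -/
theorem line_eq_fam {K : Type*} [Field K] (q : K) : fam K 0 + q • (fam K 1 - fam K 0) = fam K q := by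
  funext a b c
  simp only [Pi.add_apply, Pi.smul_apply, Pi.sub_apply, smul_eq_mul]
  rcases a with a | a <;> rcases c with c | c <;> simp [famW]
  split_ifs <;> ring

/-- `R̃(𝔖(1)) = R̃(⟨2,2,2⟩) = 2^ω`: the special point of the line. [cite: BlaserChristandlZuiddam2017, §2] -/
theorem asymptoticRank_fam_one : asymptoticRank (fam ℂ 1) = (2 : ℝ) ^ omega ℂ := by
  have h : famW ℂ 1 = fun _ => 1 := funext fun x => by simp [famW]
  show asymptoticRank (weightedStar ℂ 2 1 (famW ℂ 1)) = _
  rw [h]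
  exact asymptoticRank_weightedStar_one

/-- **Sublevel dichotomy on the BCZ line**: for every level `r`, the members `𝔖(q)` with
`R̃(𝔖(q)) ≤ r` are ALL of them or FINITELY many. [cite: ChristandlHoeberechtsNieuwboerVranaZuiddam2025, Theorem 1.2] -/
theorem flatLocus_eq_univ_or_finite (r : ℝ) :
    {q : ℂ | asymptoticRank (fam ℂ q) ≤ r} = Set.univ ∨
      {q : ℂ | asymptoticRank (fam ℂ q) ≤ r}.Finite := by
  simpa only [line_eq_fam] using sublevel_eq_univ_or_finite (fam ℂ 0) (fam ℂ 1 - fam ℂ 0) r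

/-- **A dominant modulus exists**: some `𝔖(q₀)` has the largest asymptotic rank on the line (the
generic asymptotic rank `r_gen` of the same-support stratum of `⟨2,2,2⟩` in BCZ normal form).
[cite: ChristandlHoeberechtsNieuwboerVranaZuiddam2025, Corollary 4.4] -/
theorem exists_dominant_fam :
    ∃ q₀ : ℂ, ∀ q, asymptoticRank (fam ℂ q) ≤ asymptoticRank (fam ℂ q₀) := by
  simpa only [line_eq_fam] using
    exists_dominant not_countable_complex (fam ℂ 0) (fam ℂ 1 - fam ℂ 0)

/-- **Generic domination of the summit point: `2^ω = R̃(⟨2,2,2⟩) ≤ R̃(𝔖(q₀))`** for every dominant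
modulus `q₀`. [cite: ChristandlHoeberechtsNieuwboerVranaZuiddam2025, §1.2 (remark on cw₂), Theorem 1.2] -/
theorem rpow_omega_le_asymptoticRank_fam_of_dominant {q₀ : ℂ}
    (hq₀ : ∀ q, asymptoticRank (fam ℂ q) ≤ asymptoticRank (fam ℂ q₀)) :
    (2 : ℝ) ^ omega ℂ ≤ asymptoticRank (fam ℂ q₀) :=
  asymptoticRank_fam_one ▸ hq₀ 1

/-- **The generic member bounds `ω` with the identity exponent map: `R̃(𝔖(q₀)) ≤ 2^τ ⟹ ω ≤ τ`**
for a dominant `q₀` (compare the per-member Cohn–Umans door `ω ≤ (3τ − 2)/2`,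
`omega_le_of_asymptoticRank_weightedStar_le`). [cite: ChristandlHoeberechtsNieuwboerVranaZuiddam2025, Theorem 1.2] -/
theorem omega_le_of_dominant {q₀ : ℂ}
    (hq₀ : ∀ q, asymptoticRank (fam ℂ q) ≤ asymptoticRank (fam ℂ q₀)) {τ : ℝ}
    (h : asymptoticRank (fam ℂ q₀) ≤ (2 : ℝ) ^ τ) : omega ℂ ≤ τ :=
  (Real.rpow_le_rpow_left_iff one_lt_two).1 ((rpow_omega_le_asymptoticRank_fam_of_dominant hq₀).trans h)

/-- **Infinitely many `τ`-flat members force `ω ≤ τ`**: if `R̃(𝔖(q)) ≤ 2^τ` for infinitely many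
`q`, then for all `q` (sublevel dichotomy), in particular for `q = 1`. [cite: ChristandlHoeberechtsNieuwboerVranaZuiddam2025, Theorem 1.2] -/
theorem omega_le_of_infinite_flat {τ : ℝ}
    (h : {q : ℂ | asymptoticRank (fam ℂ q) ≤ (2 : ℝ) ^ τ}.Infinite) : omega ℂ ≤ τ := by
  have huniv := (flatLocus_eq_univ_or_finite ((2 : ℝ) ^ τ)).resolve_right h
  have h1 : asymptoticRank (fam ℂ 1) ≤ (2 : ℝ) ^ τ :=
    show (1 : ℂ) ∈ {q : ℂ | asymptoticRank (fam ℂ q) ≤ (2 : ℝ) ^ τ} from huniv ▸ Set.mem_univ _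
  rw [asymptoticRank_fam_one] at h1
  exact (Real.rpow_le_rpow_left_iff one_lt_two).1 h1

/-- **Infinitely many flat members force the summit**: `{q | R̃(𝔖(q)) ≤ 4}` infinite ⟹ `ω = 2`
(one flat member `q ≠ 0` already suffices by the Cohn–Umans door; recorded for the dichotomy).
[cite: CohnUmans2013, Thm. 6] -/
theorem summit_of_infinite_flat (h : {q : ℂ | asymptoticRank (fam ℂ q) ≤ 4}.Infinite) :
    _root_.MatrixMultiplication := by
  obtain ⟨q, hq, hq0⟩ := h.exists_notMem_finset {0}
  exact summit_of_asymptoticRank_fam_le_four (by simpa using hq0) hq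

/-- **The special members are countable**: for every modulus `q₀` only countably many `q` have
`R̃(𝔖(q)) < R̃(𝔖(q₀))`; for a dominant `q₀`, off this countable set `R̃(𝔖(q))` equals the generic
value. [cite: ChristandlHoeberechtsNieuwboerVranaZuiddam2025, Theorem 1.2] -/
theorem countable_special_fam (q₀ : ℂ) :
    {q : ℂ | asymptoticRank (fam ℂ q) < asymptoticRank (fam ℂ q₀)}.Countable := by
  simpa only [line_eq_fam] using countable_special (fam ℂ 0) (fam ℂ 1 - fam ℂ 0) q₀

/-- **Finitely many special members below each level**: for `c < R̃(𝔖(q₀))` (any `q₀`, e.g. a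
dominant one) only finitely many `q` have `R̃(𝔖(q)) ≤ c`. [cite: ChristandlHoeberechtsNieuwboerVranaZuiddam2025, Theorem 1.2] -/
theorem finite_special_fam_below {q₀ : ℂ} {c : ℝ}
    (hc : c < asymptoticRank (fam ℂ q₀)) : {q : ℂ | asymptoticRank (fam ℂ q) ≤ c}.Finite := by
  have h := finite_sublevel_of_lt (t₀ := fam ℂ 0) (t₁ := fam ℂ 1 - fam ℂ 0) (q₀ := q₀) (c := c)
    (by simpa only [line_eq_fam] using hc)
  simpa only [line_eq_fam] using h

/-- Off the countable special set every member realises the generic value and dominates `2^ω`: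
for `q` with `¬ R̃(𝔖(q)) < R̃(𝔖(q₀))`, `R̃(𝔖(q)) = R̃(𝔖(q₀)) ≥ 2^ω`. [cite: ChristandlHoeberechtsNieuwboerVranaZuiddam2025, Theorem 1.2] -/
theorem generic_member {q₀ : ℂ}
    (hq₀ : ∀ q, asymptoticRank (fam ℂ q) ≤ asymptoticRank (fam ℂ q₀)) {q : ℂ}
    (hq : q ∉ {q : ℂ | asymptoticRank (fam ℂ q) < asymptoticRank (fam ℂ q₀)}) :
    asymptoticRank (fam ℂ q) = asymptoticRank (fam ℂ q₀) ∧
      (2 : ℝ) ^ omega ℂ ≤ asymptoticRank (fam ℂ q) := by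
  have heq : asymptoticRank (fam ℂ q) = asymptoticRank (fam ℂ q₀) :=
    le_antisymm (hq₀ q) (not_lt.1 hq)
  exact ⟨heq, heq ▸ rpow_omega_le_asymptoticRank_fam_of_dominant hq₀⟩

/-- **The dichotomy at the summit level.** With `r_gen = R̃(𝔖(q₀))` the generic value:
either `r_gen ≤ 4` — then EVERY member is flat and `ω = 2` — or `4 < r_gen` and the flat members
`{q | R̃(𝔖(q)) ≤ 4}` are finitely many (under `ω > 2` at most `q = 0`,
`four_lt_asymptoticRank_weightedStar_of_not_summit`). [cite: ChristandlHoeberechtsNieuwboerVranaZuiddam2025, Theorem 1.2] -/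
theorem flat_dichotomy {q₀ : ℂ}
    (hq₀ : ∀ q, asymptoticRank (fam ℂ q) ≤ asymptoticRank (fam ℂ q₀)) :
    (asymptoticRank (fam ℂ q₀) ≤ 4 ∧ (∀ q, asymptoticRank (fam ℂ q) ≤ 4) ∧
        _root_.MatrixMultiplication) ∨
      (4 < asymptoticRank (fam ℂ q₀) ∧ {q : ℂ | asymptoticRank (fam ℂ q) ≤ 4}.Finite) := by
  rcases le_or_gt (asymptoticRank (fam ℂ q₀)) 4 with hle | hlt
  · refine Or.inl ⟨hle, fun q => (hq₀ q).trans hle, ?_⟩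
    exact summit_of_asymptoticRank_fam_le_four one_ne_zero ((hq₀ 1).trans hle)
  · exact Or.inr ⟨hlt, finite_special_fam_below hlt⟩

/-- **`ω > 2` read on the line**: then the generic value exceeds `4` STRICTLY and so does every
member `q ≠ 0` — special and generic members fail flatness together (Kernel VIII-a), and the
generic value carries the quantitative excess `2^ω ≤ r_gen`. [cite: ConnerGesmundoLandsbergVenturaWang2020, Conj. 1.4] -/
theorem four_lt_generic_of_not_summit (hS : ¬ _root_.MatrixMultiplication) {q₀ : ℂ}
    (hq₀ : ∀ q, asymptoticRank (fam ℂ q) ≤ asymptoticRank (fam ℂ q₀)) :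
    4 < asymptoticRank (fam ℂ q₀) ∧ (2 : ℝ) ^ omega ℂ ≤ asymptoticRank (fam ℂ q₀) :=
  ⟨lt_of_lt_of_le (four_lt_asymptoticRank_weightedStar_of_not_summit hS (w := famW ℂ 1)
      (famW_ne_zero one_ne_zero)) (hq₀ 1),
    rpow_omega_le_asymptoticRank_fam_of_dominant hq₀⟩

end BCZ

end Summit.MatrixMultiplication.MatrixMultiplication.Theorems.FarEdgeDescentGenericDomination

end
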